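import Summits.Ventures.PercRepro.C041ZonePortCaseV

/-!
# The zone port problem of THEOREM R: CASE (v), the sums — `Φ (P.sub C) ≤ Φ P` for a unique one-edge gate zone of
type `{1}` (p6, gen 24)

Setting of `C041ZonePortCaseV`.  With the pattern correspondence `patternEquiv` the weight sum of `P` is the sum over
the patterns `x′` of the sub-problem of the two colours of the unique gate edge: red gives `3·[Good₁′ x′] + 1`
(valid), blue gives `3·[Good₂′ x′] − 2` (valid iff `x′` is).  Pointwise this dominates the sub-problem's summand
`3·[Good₁′] + 3·[Good₂′] − 2`, hence `phiOr_sub_le` / `phiAnd_sub_le`: `Φ (P.sub C hC) ≤ Φ P` — the paper's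
`Φ = N′ + Φ′` (exact for `V_∨`) as an inequality.
-/

namespace PercRepro

namespace ZonePort

namespace Problem

open Finset

variable {V E : Type*} [DecidableEq V] {P : Problem V E} {C : Finset V}

section Weights

variable (hC : P.IsGate C) (huniq : ∀ D, P.IsGate D → D = C) {e₀ : P.Term} (he₀ : P.tz e₀.1 = C)
  (hs₀ : P.ts e₀.1 = false) (huniqT : ∀ f : P.Term, P.tz f.1 = C → f = e₀)

include hC huniq he₀ hs₀ huniqT in
open Classical in
/-- The weight with the gate edge red. -/
theorem weight_extend_true (x' : (P.sub C hC.mem).Term → Bool) :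
    P.weight (P.extend C hC.mem x' true) = (if (P.sub C hC.mem).Good₁ x' then 3 else 0) + 1 := by
  unfold weight
  rw [if_pos (good₂_extend_true hC he₀ hs₀ huniqT x')]
  by_cases h : (P.sub C hC.mem).Good₁ x'
  · rw [if_pos h, if_pos ((good₁_extend_true_iff hC huniq hs₀ huniqT x').2 h)]
    norm_num
  · rw [if_neg h, if_neg (fun h' => h ((good₁_extend_true_iff hC huniq hs₀ huniqT x').1 h'))]
    norm_num

include hC huniq he₀ hs₀ huniqT in
open Classical in
/-- The weight with the gate edge blue. -/
theorem weight_extend_false (x' : (P.sub C hC.mem).Term → Bool) :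
    P.weight (P.extend C hC.mem x' false) = (if (P.sub C hC.mem).Good₂ x' then 3 else 0) - 2 := by
  unfold weight
  rw [if_neg (not_good₁_extend_false hC huniq he₀ hs₀ x')]
  by_cases h : (P.sub C hC.mem).Good₂ x'
  · rw [if_pos h, if_pos ((good₂_extend_false_iff hC huniq hs₀ huniqT x').2 h)]
    norm_num
  · rw [if_neg h, if_neg (fun h' => h ((good₂_extend_false_iff hC huniq hs₀ huniqT x').1 h'))]
    norm_num

end Weights

section Sums

variable [Fintype E] [DecidableEq E]
variable (hC : P.IsGate C) (huniq : ∀ D, P.IsGate D → D = C) {e₀ : P.Term} (he₀ : P.tz e₀.1 = C)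
  (hs₀ : P.ts e₀.1 = false) (huniqT : ∀ f : P.Term, P.tz f.1 = C → f = e₀) (hsw : P.sw C = true)

open Classical in
/-- The pattern sum of `P` as a sum over the sub-problem's patterns and the colour of the unique gate edge. -/
theorem sum_patterns_eq (hCZ : C ∈ P.Z) (e₀ : P.Term) (huniqT : ∀ f : P.Term, P.tz f.1 = C → f = e₀)
    (f : (P.Term → Bool) → ℤ) :
    ∑ x : P.Term → Bool, f x =
      ∑ x' : (P.sub C hCZ).Term → Bool, (f (P.extend C hCZ x' true) + f (P.extend C hCZ x' false)) := by
  rw [← (patternEquiv hCZ e₀ huniqT).symm.sum_comp f]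
  rw [Fintype.sum_prod_type]
  apply Finset.sum_congr rfl
  intro x' _
  rw [Fintype.sum_bool]
  rfl

include hC huniq he₀ hs₀ huniqT hsw in
open Classical in
/-- **CASE (v), `Φ∨`**: `Φ∨ (P.sub C) ≤ Φ∨ P` for a unique switchable gate zone carrying a single 1-edge. -/
theorem phiOr_sub_le : (P.sub C hC.mem).phiOr ≤ P.phiOr := by
  unfold phiOr
  rw [sum_patterns_eq hC.mem e₀ huniqT]
  apply Finset.sum_le_sum
  intro x' _
  rw [weight_extend_true hC huniq he₀ hs₀ huniqT, weight_extend_false hC huniq he₀ hs₀ huniqT]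
  have hadmT := adm_extend_iff hs₀ huniqT hsw hC.mem x' true
  have hadmF := adm_extend_iff hs₀ huniqT hsw hC.mem x' false
  have hX₁T := X₁_extend_true he₀ hs₀ hC.mem x'
  have hX₁F := X₁_extend_false_iff hC.mem x'
  have hX₂F := X₂_extend_iff hs₀ huniqT hC.mem x' false
  simp only [hadmT, hadmF, hX₁T, hX₁F, hX₂F, true_or, and_true, weight]
  split_ifs <;> first | omega | (exfalso; tauto)

include hC huniq he₀ hs₀ huniqT hsw in
open Classical in
/-- **CASE (v), `Φ∧`**: `Φ∧ (P.sub C) ≤ Φ∧ P` for a unique switchable gate zone carrying a single 1-edge. -/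
theorem phiAnd_sub_le : (P.sub C hC.mem).phiAnd ≤ P.phiAnd := by
  unfold phiAnd
  rw [sum_patterns_eq hC.mem e₀ huniqT]
  apply Finset.sum_le_sum
  intro x' _
  rw [weight_extend_true hC huniq he₀ hs₀ huniqT, weight_extend_false hC huniq he₀ hs₀ huniqT]
  have hadmT := adm_extend_iff hs₀ huniqT hsw hC.mem x' true
  have hadmF := adm_extend_iff hs₀ huniqT hsw hC.mem x' false
  have hX₁T := X₁_extend_true he₀ hs₀ hC.mem x'
  have hX₁F := X₁_extend_false_iff hC.mem x'
  have hX₂T := X₂_extend_iff hs₀ huniqT hC.mem x' true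
  have hX₂F := X₂_extend_iff hs₀ huniqT hC.mem x' false
  simp only [hadmT, hadmF, hX₁T, hX₁F, hX₂T, hX₂F, true_and, weight]
  split_ifs <;> first | omega | (exfalso; tauto)

end Sums

end Problem

end ZonePort

end PercRepro
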